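import Literature.NumberTheory.LFunctions.HorocycleRH
import Literature.Analysis.Complex.VerticalLineShift
import Literature.NumberTheory.LFunctions.RieszMeanPerron
import HarnessLib

/-!
# Zagier's (Z1) for closed horocycles: the Mellin-inversion glue, proved

Topic `Literature/NumberTheory/LFunctions`; companion of `HorocycleRH.lean`, whose one remaining
named fact is `Literature.NumberTheory.LFunctions.horocycleRate_of_quasiRH` (Zagier 1981, §1
p. 279, direction (Z1): under `QuasiRiemannHypothesis (2 − 2θ)` every smooth `SL(2,ℤ)`-invariant
cusp-supported `F` has horocycle averages `C(F;y) = ∫₀¹ F(x+iy) dx = c + O_ε(y^{θ−ε})`).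

Zagier's printed argument (p. 279, checked against the scanned original) has two halves:

1. (**deep input, NOT proved here, NOT asserted**) by the Rankin–Selberg unfolding
   `I(F;s) = ∫₀^∞ C(F;y) y^{s-2} dy = ∫_{Γ\ℍ} F E(·,s) dz` ((9)–(10)) and the analytic
   continuation of the Eisenstein series `E(z,s)` ((3)–(5), (14)), "the Mellin transform `I(F;s)`
   … is holomorphic in `Re(s) > Θ/2` … except for a simple pole of residue `κ` at `s = 1`", and
   "if `F` were sufficiently smooth … `I(F;σ+it) = O(t⁻²)` on any vertical strip `σ > Θ/2`";
2. (**glue, PROVED here**) "… and the Mellin inversion formula would give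
   `C(F;y) = κ + O(y^{1−Θ/2−ε})`."

This file proves half 2 in Mathlib's language and reduces the named fact to half 1:

* `isBigO_nhdsGT_zero_of_mellin_continuation` — **Mellin inversion with a contour shift**: if
  `φ` is bounded, continuous on `(0,∞)`, zero on `[y₀,∞)`, and `G` is holomorphic on `re s > a`,
  equal on `re s > 1` to `∫₀^∞ φ(t)t^{s-2} dt − κ/((s−1)s)` and `O(1/(1+t²))` uniformly on
  `σ' ≤ re s ≤ 2` (`a < σ' < 1`, `σ' ≥ 0`), then `φ(y) − κ = O(y^{1−σ'})` at `0⁺`. Proof: subtract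
  `κ` times the tent `(1−t)⁺`, whose Mellin transform at `s − 1` is `1/((s−1)s)` (tree
  `hasMellin_oneSub_indicator`, `RieszMeanPerron.lean`); Mathlib's `mellinInv_mellin_eq` on `re s = 2`; shift the line to
  `re s = σ'` with the tree's `Literature.Analysis.Complex.integral_vertical_eq_of_differentiableOn`.
* `isBigO_nhdsGT_zero_of_mellin_continuation'` — the same with the datum in Zagier's form
  (`I = H + κ/(s−1)`, `I(σ+it) = O(t⁻²)` for `|t| ≥ 1` on closed sub-strips; compactness for
  `|t| ≤ 1`).
* `exists_bound_of_invariant_of_cuspSupport`, `horocycleAverage_eq_zero_of_le`,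
  `continuousOn_horocycleAverage_of_continuousOn_of_continuousOn` — the route's test functions `F` are bounded
  (Mathlib `ModularGroup.isCompact_truncatedFundamentalDomain`, `exists_smul_mem_fd`), their
  horocycle averages vanish for `y ≥ max Y 0 + 2` (translation by `T`) and are continuous in `y`.
* `horocycleRate_of_rankinSelberg_continuation` — (Z1) for one `F` from its continuation datum
  with abscissa `a`: `C(F;y) = κ + O_ε(y^{(1−a)−ε})`.
* `horocycleRate_of_quasiRH_of_rankinSelberg` — `horocycleRate_of_quasiRH` from half 1 stated as
  a hypothesis in the abscissa language of `HorocycleRH.lean` (`Θ ≤ σ₀`, `a = σ₀/2`).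

What is deliberately NOT here: half 1 (the theory of `E(z,s)`, absent from Mathlib), and any new
named fact — the hypothesis of the last theorem is a binder, not a `def`. An elementary route to
(Z1) through the tree's unfolding (`HorocycleRateHalf.lean`) and `M(x) = O(x^{θ+ε})` under
quasi-RH (`QuasiRHFactsProofs.lean`) is the subject of later files.

## References

* D. Zagier, *Eisenstein series and the Riemann zeta-function*, in: Automorphic Forms,
  Representation Theory and Arithmetic (Bombay 1979), Springer/Tata 1981, 275–301, §1 pp. 277–280
  [Zagier1981].
* P. Sarnak, *Asymptotic behavior of periodic orbits of the horocycle flow and Eisenstein series*,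
  Comm. Pure Appl. Math. 34 (1981), 719–739, Thm. 1 [Sarnak1981].

## Mathlib / tree search

Mathlib: `mellinInv_mellin_eq`, `hasMellin_sub`,
`integral_univ_inv_one_add_sq`, `ModularGroup.isCompact_truncatedFundamentalDomain`,
`ModularGroup.coe_T_zpow_smul_eq`. Tree: `Literature.Analysis.Complex.integral_vertical_eq_of_differentiableOn`
(`VerticalLineShift.lean`) and `hasMellin_oneSub_indicator` (`RieszMeanPerron.lean`), both reused;
the many Perron/Mellin files of this topic shift specific
integrands — no general "continuation datum ⇒ asymptotics" lemma (`lean search 'mellinInv'`).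
-/

noncomputable section

open _root_.Complex _root_.MeasureTheory Filter Asymptotics Set intervalIntegral
open scoped _root_.Topology

namespace Literature.NumberTheory.LFunctions

/-! ### Mellin inversion with a contour shift -/

/-- Shifting the line of an absolutely convergent vertical integral across a strip on which the
integrand is holomorphic and `O(1/(1+y²))` uniformly (corollary of the tree's
`Literature.Analysis.Complex.integral_vertical_eq_of_differentiableOn`, whose integrability and
horizontal-decay hypotheses follow from the uniform bound). [folklore] -/
theorem integral_vertical_eq_of_norm_le_div {f : ℂ → ℂ} {σ₁ σ₂ C : ℝ} (hσ : σ₁ ≤ σ₂)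
    (hd : DifferentiableOn ℂ f (re ⁻¹' Icc σ₁ σ₂))
    (hb : ∀ x y : ℝ, x ∈ Icc σ₁ σ₂ → ‖f (x + y * I)‖ ≤ C / (1 + y ^ 2)) :
    ∫ y : ℝ, f (σ₁ + y * I) = ∫ y : ℝ, f (σ₂ + y * I) := by
  have hC0 : 0 ≤ C := by
    have h := (norm_nonneg _).trans (hb σ₁ 0 (left_mem_Icc.2 hσ))
    simpa using h
  -- integrability on each vertical line of the strip
  have hint : ∀ x ∈ Icc σ₁ σ₂, Integrable fun y : ℝ => f (x + y * I) := by
    intro x hx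
    have hcont : Continuous fun y : ℝ => f (x + y * I) := by
      refine hd.continuousOn.comp_continuous (by fun_prop) ?_
      intro y
      simpa using hx
    refine Integrable.mono' ((integrable_inv_one_add_sq).const_mul C) hcont.aestronglyMeasurable ?_
    filter_upwards with y
    simpa [div_eq_mul_inv] using hb x y hx
  refine Literature.Analysis.Complex.integral_vertical_eq_of_differentiableOn hσ hd
    (hint σ₁ (left_mem_Icc.2 hσ)) (hint σ₂ (right_mem_Icc.2 hσ)) fun ε hε => ?_
  -- horizontal decay: `C/(1+T²) ≤ ε` once `|T| ≥ max (C/ε) 1`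
  refine ⟨max (C / ε) 1, fun T hT x hx => (hb x T hx).trans ?_⟩
  have hT1 : 1 ≤ |T| := (le_max_right _ _).trans hT
  have hT2 : C / ε ≤ |T| := (le_max_left _ _).trans hT
  rw [div_le_iff₀ (by positivity)]
  have h1 : C ≤ ε * |T| := by rwa [div_le_iff₀' hε] at hT2
  have h2 : |T| ≤ 1 + T ^ 2 := by nlinarith [sq_abs T, abs_nonneg T]
  nlinarith

/-- Mellin convergence on the line `re s = 1` for a bounded function, continuous on `(0, ∞)` and
vanishing on `[y₀, ∞)`. [folklore] -/
theorem mellinConvergent_of_bounded_of_eventually_zero {φ : ℝ → ℂ} {y₀ M : ℝ}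
    (hφc : ContinuousOn φ (Ioi 0)) (hφb : ∀ y, 0 < y → ‖φ y‖ ≤ M)
    (hφ0 : ∀ y, y₀ ≤ y → φ y = 0) (y : ℝ) : MellinConvergent φ (1 + y * I) := by
  have hmeas : AEStronglyMeasurable φ (volume.restrict (Ioi 0)) :=
    hφc.aestronglyMeasurable measurableSet_Ioi
  rw [MellinConvergent, mellin_convergent_iff_norm Subset.rfl measurableSet_Ioi hmeas]
  have hre : (1 + (y : ℂ) * I).re - 1 = 0 := by simp
  simp only [hre, Real.rpow_zero, one_mul]
  -- reduce to the bounded interval `Ioc 0 Y`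
  set Y := max y₀ 1 with hY
  have hsplit : Ioi (0 : ℝ) = Ioc 0 Y ∪ Ioi Y := (Ioc_union_Ioi_eq_Ioi (by positivity)).symm
  rw [hsplit]
  refine IntegrableOn.union ?_ ?_
  · have hfin : IntegrableOn (fun _ : ℝ => M) (Ioc 0 Y) := integrableOn_const (by simp)
    refine Integrable.mono' hfin ?_ ?_
    · exact (hmeas.mono_set Ioc_subset_Ioi_self).norm
    · refine (ae_restrict_iff' measurableSet_Ioc).2 (Eventually.of_forall fun t ht => ?_)
      simpa using hφb t ht.1
  · refine (integrableOn_zero).congr_fun (fun t ht => ?_) measurableSet_Ioi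
    have : y₀ ≤ t := (le_max_left _ _).trans (le_of_lt ht)
    simp [hφ0 t this]

/-- **Mellin inversion with a contour shift** (the analytic lemma behind Zagier 1981, p. 279,
"the Mellin inversion formula would give `C(F;y) = κ + O(y^{1-σ})`"). Let `φ` be bounded,
continuous on `(0,∞)` and zero on `[y₀,∞)`, and suppose `G` is holomorphic on `re s > a`, equal
for `re s > 1` to `∫₀^∞ φ(t) t^{s-2} dt − κ/((s-1)s)` (Zagier's `I(F;s)` minus the Mellin
transform of the tent `κ (1-t)⁺`), and `O(1/(1+y²))` uniformly on the closed strip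
`σ' ≤ re s ≤ 2` for some `σ' ∈ (a,1)`, `σ' ≥ 0`. Then `φ(y) − κ = O(y^{1-σ'})` as `y → 0⁺`.
Real proof: Mathlib's `mellinInv_mellin_eq` on `re s = 2` and Cauchy–Goursat on rectangles
(`integral_vertical_eq_of_norm_le_div`). [folklore] -/
theorem isBigO_nhdsGT_zero_of_mellin_continuation {φ : ℝ → ℂ} {y₀ M a σ' : ℝ} {κ : ℂ}
    {G : ℂ → ℂ} (hφc : ContinuousOn φ (Ioi 0)) (hφb : ∀ y, 0 < y → ‖φ y‖ ≤ M)
    (hφ0 : ∀ y, y₀ ≤ y → φ y = 0) (hσ' : a < σ') (hσ'0 : 0 ≤ σ') (hσ'1 : σ' < 1)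
    (hG : DifferentiableOn ℂ G {s : ℂ | a < s.re})
    (hGeq : ∀ s : ℂ, 1 < s.re → G s = mellin φ (s - 1) - κ / ((s - 1) * s))
    (hGb : ∃ C, ∀ x y : ℝ, x ∈ Icc σ' 2 → ‖G (x + y * I)‖ ≤ C / (1 + y ^ 2)) :
    (fun y : ℝ => φ y - κ) =O[𝓝[>] 0] fun y : ℝ => y ^ (1 - σ') := by
  obtain ⟨C, hC⟩ := hGb
  have hC0 : 0 ≤ C := by
    have := hC 2 0 ⟨by linarith, le_rfl⟩
    have h := (norm_nonneg _).trans this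
    simpa using h
  -- the tent `(1 - t)⁺` (Mellin transform `1/(s(s+1))`, tree `hasMellin_oneSub_indicator`)
  set ψ : ℝ → ℂ := (Ioc 0 1).indicator fun t : ℝ => (1 : ℂ) - t with hψ
  have hψmem : ∀ t : ℝ, t ∈ Ioc (0 : ℝ) 1 → ψ t = 1 - t := fun t ht => by
    simp [hψ, indicator_of_mem ht]
  -- the test function fed to Mellin inversion
  set f : ℝ → ℂ := fun t => φ t - κ • ψ t with hf
  -- its Mellin transform on the line `re s = 1` is `G (s + 1)`
  have hmellin : ∀ y : ℝ, MellinConvergent f (1 + y * I) ∧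
      mellin f (1 + y * I) = G (2 + y * I) := by
    intro y
    have hφ := mellinConvergent_of_bounded_of_eventually_zero hφc hφb hφ0 y
    have ht := hasMellin_oneSub_indicator (s := 1 + y * I) (by simp)
    have hsub := hasMellin_sub hφ (ht.1.const_smul κ)
    refine ⟨hsub.1, ?_⟩
    rw [hsub.2, mellin_const_smul, ht.2, hGeq (2 + y * I) (by simp)]
    have e1 : (2 : ℂ) + y * I - 1 = 1 + y * I := by ring
    have e2 : (1 : ℂ) + y * I + 1 = 2 + y * I := by ring
    rw [e1, e2, smul_eq_mul, mul_one_div]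
  -- continuity of `y ↦ G (x + iy)` and integrability on the lines of the strip
  have hGcont : ∀ x : ℝ, a < x → Continuous fun y : ℝ => G (x + y * I) := by
    intro x hx
    refine hG.continuousOn.comp_continuous (by fun_prop) fun y => ?_
    simpa using hx
  have hGint : ∀ x : ℝ, x ∈ Icc σ' 2 → Integrable fun y : ℝ => G (x + y * I) := by
    intro x hx
    refine Integrable.mono' ((integrable_inv_one_add_sq).const_mul C)
      (hGcont x (hσ'.trans_le hx.1)).aestronglyMeasurable ?_
    filter_upwards with y
    simpa [div_eq_mul_inv] using hC x y hx
  have hvert : VerticalIntegrable (mellin f) 1 := by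
    have : (fun y : ℝ => mellin f (1 + y * I)) = fun y : ℝ => G (2 + y * I) :=
      funext fun y => (hmellin y).2
    rw [VerticalIntegrable, show ((1 : ℝ) : ℂ) = 1 from ofReal_one, this]
    exact hGint 2 ⟨by linarith, le_rfl⟩
  -- the bound, pointwise on `(0,1)`
  refine IsBigO.of_bound (C / 2 + ‖κ‖) ?_
  filter_upwards [Ioo_mem_nhdsGT (zero_lt_one' ℝ)] with x hx
  have hx0 : (0 : ℝ) < x := hx.1
  have hx1 : x < 1 := hx.2
  have hxC : (x : ℂ) ≠ 0 := ofReal_ne_zero.2 hx0.ne'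
  -- Mellin inversion at `x`
  have hψcont : ContinuousAt ψ x := by
    have h : ψ =ᶠ[𝓝 x] fun t : ℝ => 1 - (t : ℂ) := by
      filter_upwards [Ioo_mem_nhds hx0 hx1] with t ht
      exact hψmem t ⟨ht.1, ht.2.le⟩
    exact (continuousAt_congr h).2 (by fun_prop)
  have hcont : ContinuousAt f x :=
    (hφc.continuousAt (Ioi_mem_nhds hx0)).sub (hψcont.const_smul κ)
  have hinv := mellinInv_mellin_eq 1 f hx0 (by simpa using (hmellin 0).1) hvert hcont
  -- rewrite the inverse transform as a vertical integral of `g s = x^{1-s} G s` over `re s = 2`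
  set g : ℂ → ℂ := fun s => (x : ℂ) ^ (1 - s) * G s with hg
  have hinv' : f x = (1 / (2 * Real.pi) : ℝ) • ∫ y : ℝ, g (2 + y * I) := by
    rw [← hinv, mellinInv]
    congr 1
    refine integral_congr_ae (Eventually.of_forall fun y => ?_)
    have e : -(1 + (y : ℂ) * I) = 1 - (2 + (y : ℂ) * I) := by ring
    simp only [hg, ofReal_one, (hmellin y).2, smul_eq_mul, e]
  -- shift the contour to `re s = σ'`
  have hgd : DifferentiableOn ℂ g (re ⁻¹' Icc σ' 2) := by
    intro s hs
    have hs' : a < s.re := hσ'.trans_le hs.1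
    refine DifferentiableAt.differentiableWithinAt ?_
    refine DifferentiableAt.mul ?_ (hG.differentiableAt (IsOpen.mem_nhds ?_ hs'))
    · exact DifferentiableAt.const_cpow (by fun_prop) (Or.inl hxC)
    · exact isOpen_lt continuous_const continuous_re
  have hxpow : ∀ u : ℝ, u ∈ Icc σ' 2 → ∀ y : ℝ,
      ‖(x : ℂ) ^ (1 - ((u : ℂ) + y * I))‖ = x ^ (1 - u) := by
    intro u hu y
    rw [norm_cpow_eq_rpow_re_of_pos hx0]
    simp
  have hgb : ∀ u y : ℝ, u ∈ Icc σ' 2 → ‖g (u + y * I)‖ ≤ x⁻¹ * C / (1 + y ^ 2) := by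
    intro u y hu
    rw [hg, norm_mul, hxpow u hu y, mul_div_assoc]
    refine mul_le_mul ?_ (hC u y hu) (norm_nonneg _) (inv_pos.2 hx0).le
    rw [← Real.rpow_neg_one]
    exact Real.rpow_le_rpow_of_exponent_ge hx0 hx1.le (by linarith [hu.2])
  have hshift : ∫ y : ℝ, g (σ' + y * I) = ∫ y : ℝ, g (2 + y * I) := by
    simpa only [ofReal_ofNat] using
      integral_vertical_eq_of_norm_le_div (by linarith) hgd hgb
  -- estimate on the line `re s = σ'`
  have hbound : ‖∫ y : ℝ, g (σ' + y * I)‖ ≤ C * x ^ (1 - σ') * Real.pi := by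
    have hle : ∀ y : ℝ, ‖g (σ' + y * I)‖ ≤ C * x ^ (1 - σ') * (1 + y ^ 2)⁻¹ := by
      intro y
      rw [hg, norm_mul, hxpow σ' ⟨le_rfl, by linarith⟩ y]
      have := hC σ' y ⟨le_rfl, by linarith⟩
      calc x ^ (1 - σ') * ‖G (σ' + y * I)‖ ≤ x ^ (1 - σ') * (C / (1 + y ^ 2)) :=
            mul_le_mul_of_nonneg_left this (Real.rpow_nonneg hx0.le _)
        _ = C * x ^ (1 - σ') * (1 + y ^ 2)⁻¹ := by ring
    calc ‖∫ y : ℝ, g (σ' + y * I)‖ ≤ ∫ y : ℝ, C * x ^ (1 - σ') * (1 + y ^ 2)⁻¹ :=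
          norm_integral_le_of_norm_le ((integrable_inv_one_add_sq).const_mul _)
            (Eventually.of_forall hle)
      _ = C * x ^ (1 - σ') * Real.pi := by
          rw [MeasureTheory.integral_const_mul, integral_univ_inv_one_add_sq]
  -- assemble
  have hfx : ‖f x‖ ≤ C / 2 * x ^ (1 - σ') := by
    rw [hinv', ← hshift, norm_smul, Real.norm_eq_abs, abs_of_pos (by positivity)]
    calc 1 / (2 * Real.pi) * ‖∫ y : ℝ, g (σ' + y * I)‖
        ≤ 1 / (2 * Real.pi) * (C * x ^ (1 - σ') * Real.pi) :=
          mul_le_mul_of_nonneg_left hbound (by positivity)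
      _ = C / 2 * x ^ (1 - σ') := by field_simp
  have hφx : φ x - κ = f x - κ * x := by
    simp only [hf, hψmem x ⟨hx0, hx1.le⟩, smul_eq_mul]
    ring
  have hxle : x ≤ x ^ (1 - σ') := by
    conv_lhs => rw [← Real.rpow_one x]
    exact Real.rpow_le_rpow_of_exponent_ge hx0 hx1.le (by linarith)
  rw [hφx, Real.norm_of_nonneg (Real.rpow_nonneg hx0.le _)]
  calc ‖f x - κ * x‖ ≤ ‖f x‖ + ‖κ * (x : ℂ)‖ := norm_sub_le _ _
    _ ≤ C / 2 * x ^ (1 - σ') + ‖κ‖ * x := by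
        rw [norm_mul, Complex.norm_of_nonneg hx0.le]
        exact add_le_add hfx le_rfl
    _ ≤ C / 2 * x ^ (1 - σ') + ‖κ‖ * x ^ (1 - σ') :=
        add_le_add le_rfl (mul_le_mul_of_nonneg_left hxle (norm_nonneg _))
    _ = (C / 2 + ‖κ‖) * x ^ (1 - σ') := by ring


/-- The same contour-shift lemma with the datum in Zagier's form (Zagier 1981, p. 277 (9)–(12) and
p. 279): `I(s) = ∫₀^∞ φ(t) t^{s-2} dt` equals `H(s) + κ/(s-1)` for `re s > 1` with `H` holomorphic
on `re s > a ≥ 0`, and `I(σ+it) = H + κ/(s-1) = O(t⁻²)` for `|t| ≥ 1` uniformly on closed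
sub-strips `σ₁ ≤ σ ≤ 2`, `σ₁ > a`. Conclusion: `φ(y) − κ = O(y^{1-σ'})` for every `σ' ∈ (a,1)`.
Real proof (reduction to `isBigO_nhdsGT_zero_of_mellin_continuation` with `G = H + κ/s`,
compactness for `|t| ≤ 1`). [cite: Zagier1981, §1 p. 279] -/
theorem isBigO_nhdsGT_zero_of_mellin_continuation' {φ : ℝ → ℂ} {y₀ M a : ℝ} {κ : ℂ}
    {H : ℂ → ℂ} (hφc : ContinuousOn φ (Ioi 0)) (hφb : ∀ y, 0 < y → ‖φ y‖ ≤ M)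
    (hφ0 : ∀ y, y₀ ≤ y → φ y = 0) (ha : 0 ≤ a) (hH : DifferentiableOn ℂ H {s : ℂ | a < s.re})
    (hHeq : ∀ s : ℂ, 1 < s.re →
      (∫ t in Ioi (0 : ℝ), φ t * (t : ℂ) ^ (s - 2)) = H s + κ / (s - 1))
    (hHb : ∀ σ₁ : ℝ, a < σ₁ → ∃ C : ℝ, ∀ x y : ℝ, x ∈ Icc σ₁ 2 → 1 ≤ |y| →
      ‖H (x + y * I) + κ / (x + y * I - 1)‖ ≤ C / y ^ 2)
    {σ' : ℝ} (hσ' : a < σ') (hσ'1 : σ' < 1) :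
    (fun y : ℝ => φ y - κ) =O[𝓝[>] 0] fun y : ℝ => y ^ (1 - σ') := by
  set G : ℂ → ℂ := fun s => H s + κ / s with hG
  have hne : ∀ s : ℂ, a < s.re → s ≠ 0 := by
    intro s hs h0
    rw [h0, zero_re] at hs
    exact absurd (ha.trans_lt hs) (lt_irrefl _)
  have hGd : DifferentiableOn ℂ G {s : ℂ | a < s.re} := by
    intro s hs
    refine (hH s hs).add ?_
    exact ((differentiableAt_const κ).div differentiableAt_id (hne s hs)).differentiableWithinAt
  have hGeq : ∀ s : ℂ, 1 < s.re → G s = mellin φ (s - 1) - κ / ((s - 1) * s) := by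
    intro s hs
    have hmel : mellin φ (s - 1) = ∫ t in Ioi (0 : ℝ), φ t * (t : ℂ) ^ (s - 2) := by
      rw [mellin]
      refine setIntegral_congr_fun measurableSet_Ioi fun t _ => ?_
      rw [smul_eq_mul, mul_comm, show s - 1 - 1 = s - 2 by ring]
    have hs0 : s ≠ 0 := hne s (by linarith [ha])
    have hs1 : s - 1 ≠ 0 := by
      intro h
      have := congrArg Complex.re h
      simp at this
      linarith
    rw [hmel, hHeq s hs, hG]
    field_simp
    ring
  -- the uniform bound on the closed strip `σ' ≤ re s ≤ 2`
  have hGb : ∃ C, ∀ x y : ℝ, x ∈ Icc σ' 2 → ‖G (x + y * I)‖ ≤ C / (1 + y ^ 2) := by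
    obtain ⟨C₁, hC₁⟩ := hHb σ' hσ'
    -- compact part
    have hK : IsCompact (Icc σ' 2 ×ℂ Icc (-1 : ℝ) 1) := isCompact_Icc.reProdIm isCompact_Icc
    have hKsub : Icc σ' 2 ×ℂ Icc (-1 : ℝ) 1 ⊆ {s : ℂ | a < s.re} := fun s hs => hσ'.trans_le hs.1.1
    obtain ⟨B, hB⟩ := hK.exists_bound_of_continuousOn (hGd.continuousOn.mono hKsub)
    refine ⟨2 * (max C₁ 0 + ‖κ‖ + max B 0), fun x y hx => ?_⟩
    have hpos : 0 < 1 + y ^ 2 := by positivity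
    rcases le_or_gt 1 |y| with hy | hy
    · -- `|y| ≥ 1`: Zagier's bound plus `‖κ/(s(s-1))‖ ≤ ‖κ‖ / y²`
      set s : ℂ := x + y * I with hs
      have hsim : s.im = y := by simp [hs]
      have hy0 : 0 < |y| := lt_of_lt_of_le one_pos hy
      have hs0 : s ≠ 0 := by
        intro h; rw [h] at hsim; simp at hsim; rw [← hsim] at hy0; simp at hy0
      have hs1 : s - 1 ≠ 0 := by
        intro h
        have : (s - 1).im = 0 := by rw [h]; simp
        simp [hs] at this
        rw [this] at hy0; simp at hy0
      have habs_s : |y| ≤ ‖s‖ := by simpa [hsim] using abs_im_le_norm s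
      have habs_s1 : |y| ≤ ‖s - 1‖ := by
        have := abs_im_le_norm (s - 1)
        simpa [hs] using this
      have hGs : G s = (H s + κ / (s - 1)) - κ / (s * (s - 1)) := by
        rw [hG]; field_simp; ring
      have h1 : ‖κ / (s * (s - 1))‖ ≤ ‖κ‖ / y ^ 2 := by
        rw [norm_div, norm_mul]
        have hy2 : y ^ 2 = |y| * |y| := by rw [← sq_abs]; ring
        rw [hy2]
        refine div_le_div_of_nonneg_left (norm_nonneg _) (mul_pos hy0 hy0) ?_
        exact mul_le_mul habs_s habs_s1 hy0.le (norm_nonneg _)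
      have h2 : ‖G s‖ ≤ (C₁ + ‖κ‖) / y ^ 2 := by
        rw [hGs, add_div]
        exact (norm_sub_le _ _).trans (add_le_add (hC₁ x y hx hy) h1)
      have hy2 : 1 ≤ y ^ 2 := by nlinarith [abs_nonneg y, sq_abs y]
      have h3 : (C₁ + ‖κ‖) / y ^ 2 ≤ 2 * (max C₁ 0 + ‖κ‖ + max B 0) / (1 + y ^ 2) := by
        rw [div_le_div_iff₀ (by positivity) hpos]
        have : C₁ + ‖κ‖ ≤ max C₁ 0 + ‖κ‖ + max B 0 := by
          linarith [le_max_left C₁ 0, le_max_right B 0]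
        have hnn : 0 ≤ max C₁ 0 + ‖κ‖ + max B 0 := by positivity
        nlinarith
      exact h2.trans h3
    · -- `|y| < 1`: compactness
      have hmem : (x : ℂ) + y * I ∈ Icc σ' 2 ×ℂ Icc (-1 : ℝ) 1 := by
        refine ⟨by simpa using hx, ?_⟩
        have := abs_lt.1 hy
        simpa using And.intro this.1.le this.2.le
      have h1 := hB _ hmem
      have hy2 : y ^ 2 < 1 := by nlinarith [abs_nonneg y, sq_abs y, abs_lt.1 hy]
      have h3 : B ≤ 2 * (max C₁ 0 + ‖κ‖ + max B 0) / (1 + y ^ 2) := by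
        rw [le_div_iff₀ hpos]
        have hnn : 0 ≤ max C₁ 0 + ‖κ‖ := by positivity
        nlinarith [le_max_left B 0, le_max_right B 0]
      exact h1.trans h3
  exact isBigO_nhdsGT_zero_of_mellin_continuation hφc hφb hφ0 hσ' (ha.trans hσ'.le) hσ'1 hGd
    hGeq hGb

/-! ### From the route's test functions to the Mellin datum -/

/-- A continuous `SL(2,ℤ)`-invariant function on `ℍ` vanishing on the fundamental domain above
height `Y` is bounded (it factors through the compact truncated fundamental domain,
Mathlib `ModularGroup.isCompact_truncatedFundamentalDomain`). Real proof. [folklore] -/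
theorem exists_bound_of_invariant_of_cuspSupport {F : ℂ → ℂ}
    (hF : ContinuousOn F {z : ℂ | 0 < z.im})
    (hinv : ∀ (g : Matrix.SpecialLinearGroup (Fin 2) ℤ) (z : UpperHalfPlane), F ↑(g • z) = F ↑z)
    (hsupp : ∃ Y : ℝ, ∀ z : UpperHalfPlane, z ∈ ModularGroup.fd → Y < z.im → F ↑z = 0) :
    ∃ B : ℝ, 0 ≤ B ∧ ∀ z : UpperHalfPlane, ‖F ↑z‖ ≤ B := by
  obtain ⟨Y, hY⟩ := hsupp
  have hK := ModularGroup.isCompact_truncatedFundamentalDomain Y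
  have hc : ContinuousOn (fun z : UpperHalfPlane => F ↑z)
      (ModularGroup.truncatedFundamentalDomain Y) :=
    (hF.comp_continuous UpperHalfPlane.continuous_coe
      fun z => show 0 < (z : ℂ).im from z.im_pos).continuousOn
  obtain ⟨B, hB⟩ := hK.exists_bound_of_continuousOn hc
  refine ⟨max B 0, le_max_right _ _, fun z => ?_⟩
  obtain ⟨g, hg⟩ := ModularGroup.exists_smul_mem_fd z
  rw [← hinv g z]
  rcases le_or_gt (g • z).im Y with h | h
  · exact (hB _ ⟨hg, h⟩).trans (le_max_left _ _)
  · rw [hY _ hg h, norm_zero]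
    exact le_max_right _ _

/-- For such `F`, the horocycle average `C(F;y) = ∫₀¹ F(x+iy) dx` vanishes for `y ≥ max Y 0 + 2`:
the points `x+iy`, `0 ≤ x ≤ 1/2`, lie in the fundamental domain above height `Y`, and the points
with `1/2 < x ≤ 1` are `T`-translates of such points. Real proof. [folklore] -/
theorem horocycleAverage_eq_zero_of_le {F : ℂ → ℂ}
    (hinv : ∀ (g : Matrix.SpecialLinearGroup (Fin 2) ℤ) (z : UpperHalfPlane), F ↑(g • z) = F ↑z)
    {Y : ℝ} (hY : ∀ z : UpperHalfPlane, z ∈ ModularGroup.fd → Y < z.im → F ↑z = 0)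
    {y : ℝ} (hy : max Y 0 + 2 ≤ y) : (∫ x in (0 : ℝ)..1, F (↑x + ↑y * I)) = 0 := by
  have hy0 : 0 < y := by linarith [le_max_right Y 0]
  have hyY : Y < y := by linarith [le_max_left Y 0]
  have hy1 : 1 ≤ y := by linarith [le_max_right Y 0]
  have hzero : ∀ x : ℝ, x ∈ Icc (0 : ℝ) 1 → F (↑x + ↑y * I) = 0 := by
    intro x hx
    have him : (↑x + ↑y * I : ℂ).im = y := by simp
    let z : UpperHalfPlane := ⟨↑x + ↑y * I, by rw [him]; exact hy0⟩
    have hzc : (z : ℂ) = ↑x + ↑y * I := rfl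
    have hzim : z.im = y := by rw [← UpperHalfPlane.coe_im, hzc, him]
    have hzre : z.re = x := by rw [← UpperHalfPlane.coe_re, hzc]; simp
    rcases le_or_gt x (1 / 2) with hx2 | hx2
    · -- `z` itself lies in the fundamental domain
      have hfd : z ∈ ModularGroup.fd := by
        refine ⟨?_, ?_⟩
        · rw [hzc, Complex.normSq_apply]
          simp
          nlinarith [hx.1]
        · rw [hzre, abs_of_nonneg hx.1]
          exact hx2
      rw [← hzc]
      exact hY z hfd (hzim ▸ hyY)
    · -- translate by `T⁻¹`
      set w : UpperHalfPlane := ModularGroup.T ^ (-1 : ℤ) • z with hw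
      have hwc : (w : ℂ) = ↑x + ↑y * I + (-1 : ℤ) := by
        rw [hw, ModularGroup.coe_T_zpow_smul_eq, hzc]
      have hwim : w.im = y := by
        rw [← UpperHalfPlane.coe_im, hwc]; simp
      have hwre : w.re = x - 1 := by
        rw [← UpperHalfPlane.coe_re, hwc]; simp; ring
      have hfd : w ∈ ModularGroup.fd := by
        refine ⟨?_, ?_⟩
        · rw [hwc, Complex.normSq_apply]
          simp
          nlinarith [hx.2]
        · rw [hwre, abs_le]
          constructor <;> linarith [hx.2]
      have := hY w hfd (hwim ▸ hyY)
      rw [hw, hinv] at this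
      rw [← hzc]
      exact this
  calc (∫ x in (0 : ℝ)..1, F (↑x + ↑y * I)) = ∫ x in (0 : ℝ)..1, (0 : ℂ) := by
        refine intervalIntegral.integral_congr fun x hx => ?_
        rw [uIcc_of_le zero_le_one] at hx
        exact hzero x hx
    _ = 0 := by simp

/-- Continuity of the horocycle average `y ↦ ∫₀¹ F(x+iy) dx` on `(0,∞)` for `F` continuous on the
upper half-plane (parametric interval integral over the subtype `(0,∞)`). Real proof. [folklore] -/
theorem continuousOn_horocycleAverage_of_continuousOn {F : ℂ → ℂ} (hF : ContinuousOn F {z : ℂ | 0 < z.im}) :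
    ContinuousOn (fun y : ℝ => ∫ x in (0 : ℝ)..1, F (↑x + ↑y * I)) (Ioi 0) := by
  rw [continuousOn_iff_continuous_restrict]
  have hc : Continuous (Function.uncurry fun (p : Ioi (0 : ℝ)) (x : ℝ) => F (↑x + ↑(p : ℝ) * I)) := by
    refine hF.comp_continuous (by fun_prop) fun q => ?_
    show 0 < (↑q.2 + ↑(q.1 : ℝ) * I : ℂ).im
    have : (↑q.2 + ↑(q.1 : ℝ) * I : ℂ).im = (q.1 : ℝ) := by simp
    rw [this]
    exact q.1.2
  exact intervalIntegral.continuous_parametric_intervalIntegral_of_continuous' hc 0 1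

/-- **Zagier's (Z1), glue** (Zagier 1981, §1 p. 279): for a test function `F` of the route's class
and a Rankin–Selberg continuation datum with abscissa `a ∈ [0,1)` — `I(F;s) = ∫₀^∞ C(F;y) y^{s-2} dy`
equals `H(s) + κ/(s-1)` on `re s > 1`, `H` holomorphic on `re s > a`, `I(F;σ+it) = O(t⁻²)`
uniformly on closed sub-strips — the horocycle averages satisfy
`C(F;y) = κ + O_ε(y^{(1-a)-ε})` for every `ε > 0`. Real proof. [cite: Zagier1981, §1 p. 279] -/
theorem horocycleRate_of_rankinSelberg_continuation {F : ℂ → ℂ}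
    (hF : ContDiffOn ℝ (⊤ : ℕ∞) F {z : ℂ | 0 < z.im})
    (hinv : ∀ (g : Matrix.SpecialLinearGroup (Fin 2) ℤ) (z : UpperHalfPlane), F ↑(g • z) = F ↑z)
    (hsupp : ∃ Y : ℝ, ∀ z : UpperHalfPlane, z ∈ ModularGroup.fd → Y < z.im → F ↑z = 0)
    {a : ℝ} (ha0 : 0 ≤ a) {κ : ℂ} {H : ℂ → ℂ}
    (hH : DifferentiableOn ℂ H {s : ℂ | a < s.re})
    (hHeq : ∀ s : ℂ, 1 < s.re →
      (∫ y in Ioi (0 : ℝ), (∫ x in (0 : ℝ)..1, F (↑x + ↑y * I)) * (y : ℂ) ^ (s - 2))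
        = H s + κ / (s - 1))
    (hHb : ∀ σ₁ : ℝ, a < σ₁ → ∃ C : ℝ, ∀ σ t : ℝ, σ ∈ Icc σ₁ 2 → 1 ≤ |t| →
      ‖H (σ + t * I) + κ / (σ + t * I - 1)‖ ≤ C / t ^ 2) :
    ∀ ε : ℝ, 0 < ε → (fun y : ℝ => (∫ x in (0 : ℝ)..1, F (↑x + ↑y * I)) - κ) =O[𝓝[>] 0]
      fun y : ℝ => y ^ ((1 - a) - ε) := by
  intro ε hε
  obtain ⟨Y, hY⟩ := hsupp
  obtain ⟨B, hB0, hB⟩ := exists_bound_of_invariant_of_cuspSupport hF.continuousOn hinv ⟨Y, hY⟩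
  -- the three properties of `φ = C(F;·)`
  have hφc := continuousOn_horocycleAverage_of_continuousOn hF.continuousOn
  have hφb : ∀ y : ℝ, 0 < y → ‖∫ x in (0 : ℝ)..1, F (↑x + ↑y * I)‖ ≤ B := by
    intro y hy
    have : ‖∫ x in (0 : ℝ)..1, F (↑x + ↑y * I)‖ ≤ B * |1 - 0| := by
      refine intervalIntegral.norm_integral_le_of_norm_le_const fun x _ => ?_
      have him : (↑x + ↑y * I : ℂ).im = y := by simp
      exact hB ⟨↑x + ↑y * I, by rw [him]; exact hy⟩
    simpa using this
  have hφ0 : ∀ y : ℝ, max Y 0 + 2 ≤ y → (∫ x in (0 : ℝ)..1, F (↑x + ↑y * I)) = 0 :=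
    fun y hy => horocycleAverage_eq_zero_of_le hinv hY hy
  rcases lt_or_ge ε (1 - a) with hε1 | hε1
  · have h := isBigO_nhdsGT_zero_of_mellin_continuation' hφc hφb hφ0 ha0 hH hHeq hHb
      (σ' := a + ε) (by linarith) (by linarith)
    have e : 1 - (a + ε) = 1 - a - ε := by ring
    rwa [e] at h
  · -- trivial range `ε ≥ 1 - a`: the left side is bounded and `y^{(1-a)-ε} ≥ 1` on `(0,1)`
    refine IsBigO.of_bound (B + ‖κ‖) ?_
    filter_upwards [Ioo_mem_nhdsGT (zero_lt_one' ℝ)] with y hy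
    have h1 : (1 : ℝ) ≤ y ^ (1 - a - ε) :=
      Real.one_le_rpow_of_pos_of_le_one_of_nonpos hy.1 hy.2.le (by linarith)
    rw [Real.norm_of_nonneg (Real.rpow_nonneg hy.1.le _)]
    calc ‖(∫ x in (0 : ℝ)..1, F (↑x + ↑y * I)) - κ‖ ≤ B + ‖κ‖ :=
          (norm_sub_le _ _).trans (add_le_add (hφb y hy.1) le_rfl)
      _ ≤ (B + ‖κ‖) * y ^ (1 - a - ε) := le_mul_of_one_le_right (by positivity) h1

/-- **Zagier's (Z1) reduced to the Rankin–Selberg continuation datum.** The named fact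
`horocycleRate_of_quasiRH` follows (real proof: Mellin inversion, contour shift, fundamental-domain
geometry, all above) from the deep input it rests on, stated here as the hypothesis `hA` in the
abscissa language of this file — Zagier 1981, p. 277 (9)–(12) and p. 279: under
`QuasiRiemannHypothesis σ₀` (so `Θ ≤ σ₀`), for every smooth `SL(2,ℤ)`-invariant cusp-supported `F`
the Rankin–Selberg transform `I(F;s) = ∫₀^∞ C(F;y) y^{s-2} dy = ∫_{Γ\ℍ} F E(·,s) dz` is holomorphic
on `re s > σ₀/2` up to a simple pole `κ/(s-1)` ("the only singularity for `re s > Θ/2`") and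
`I(F;σ+it) = O(t⁻²)` on vertical strips `σ > σ₀/2` ("if `F` were sufficiently smooth"). That input
is the theory of the non-holomorphic Eisenstein series `E(z,s)` ((1)–(5), (14), (18)), absent from
Mathlib; it is NOT asserted here. [cite: Zagier1981, §1 pp. 277–279] -/
theorem horocycleRate_of_quasiRH_of_rankinSelberg
    (hA : ∀ σ₀ : ℝ, 1 / 2 ≤ σ₀ → σ₀ ≤ 1 → QuasiRiemannHypothesis σ₀ →
      ∀ F : ℂ → ℂ, ContDiffOn ℝ (⊤ : ℕ∞) F {z : ℂ | 0 < z.im} →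
        (∀ (g : Matrix.SpecialLinearGroup (Fin 2) ℤ) (z : UpperHalfPlane), F ↑(g • z) = F ↑z) →
        (∃ Y : ℝ, ∀ z : UpperHalfPlane, z ∈ ModularGroup.fd → Y < z.im → F ↑z = 0) →
        ∃ (κ : ℂ) (H : ℂ → ℂ), DifferentiableOn ℂ H {s : ℂ | σ₀ / 2 < s.re} ∧
          (∀ s : ℂ, 1 < s.re →
            (∫ y in Ioi (0 : ℝ), (∫ x in (0 : ℝ)..1, F (↑x + ↑y * I)) * (y : ℂ) ^ (s - 2))
              = H s + κ / (s - 1)) ∧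
          (∀ σ₁ : ℝ, σ₀ / 2 < σ₁ → ∃ C : ℝ, ∀ σ t : ℝ, σ ∈ Icc σ₁ 2 → 1 ≤ |t| →
            ‖H (σ + t * I) + κ / (σ + t * I - 1)‖ ≤ C / t ^ 2)) :
    horocycleRate_of_quasiRH := by
  intro θ h₁ h₂ hq F hF hinv hsupp
  obtain ⟨κ, H, hH, hHeq, hHb⟩ := hA (2 - 2 * θ) (by linarith) (by linarith) hq F hF hinv hsupp
  refine ⟨κ, fun ε hε => ?_⟩
  have h := horocycleRate_of_rankinSelberg_continuation hF hinv hsupp (a := (2 - 2 * θ) / 2)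
    (by linarith) hH hHeq hHb ε hε
  have e : 1 - (2 - 2 * θ) / 2 - ε = θ - ε := by ring
  rwa [e] at h

end Literature.NumberTheory.LFunctions

end
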